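import Literature.AnabelianGeometry.AbsoluteAnabelian.AbsTopIII.BiAnabelianCompatibilityCrossCells

/-!
# [AbsTopIII] Cor. 3.7 (iii) — `K₀` on the whiskered type-(1) cell, under `ι_log` over Galois

[cite: MochizukiAbsTopIII2015, Cor 3.7 (iii) p.88] [cite: MochizukiAbsTopIII2015, Def 3.1 (iv) p.69]

abc-iut-L4-t5 (gen 6), row «COR37-COMPAT-LITERAL», step (2)(a) of
HOME/staging/L4/L4-t5/DISCHARGE-PLAN-Cor37-compat.md: the twin of `coresFamily_η_timesGal_app`
(`BiAnabelianCompatibilityCrossCells`, type (2)) for the type-(1) generator of the observable `𝔖†_log`,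
`([λ^×]∘[pr_⋎]∘[log_𝒳], [λ^{×pf}]∘[pr_{⋎+1}])` out of the row-1 vertex `⋎+1`, whiskered into `𝔈` and behind an
arbitrary path `γ`: under the hypothesis (Hlog) "`ι_log` lies over the canonical identification of Galois groups"
(`(𝒩 → 𝔈)(ι_{log,A}) = lamTimesGal_{log A} ≫ logGal_A ≫ lamTimesPfGal_A⁻¹`, objectwise; TRUE in the model,
`TFModel.modelSetting_iotaLog_overGal`), the homotopy of the universal family `K₀` over `𝔈` at
`([toGal]∘[λ^×]∘[pr_⋎]∘[log_𝒳]∘[γ], [toGal]∘[λ^{×pf}]∘[pr_{⋎+1}]∘[γ])` IS `(𝒩 → 𝔈)(ι_{log,⋎})` behind `γ` — the homotopy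
the whiskering law of Def. 3.5 (ii) demands of any family containing `𝔖†_log`. Together with the type-(2) lemma
this is the complete cross condition between `K₀` and the generators of `𝔖†_log` (Cor. 3.7 (iii), second
clause: "compatible with the families of homotopies that constitute the core [...] structures"); the
specialisations at `γ = ∅` are recorded for both types. Proof-only; model-level bookkeeping over
abc-iut-L4-t9's abstract `BiAnabelianSetting`; nothing here bears on [IUTchIII] Cor. 3.12.
-/

set_option autoImplicit false

namespace Literature.AnabelianGeometry.AbsoluteAnabelian.AbsTopIII

open CategoryTheory Quiver
open Literature.AnabelianGeometry.AbsoluteAnabelian.DiagramOfCategories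

universe u

namespace BiAnabelianSetting

variable {X E N : Type u} [Category.{u} X] [Category.{u} E] [Category.{u} N]
  (𝔖 : BiAnabelianSetting X E N)

/-- Along `pr_⋎` the augmentation 2-cell is the identity (`log_𝒳` acts on the first factor, `pr ⋙ gal` is
undisturbed). [cite: MochizukiAbsTopIII2015, Cor 3.7 (i) p.87] -/
theorem overE_μ_pr_hom_app (n : ℤ) (y : 𝔖.Sq) :
    (𝔖.overE.μ (Cor37Edge.pr n)).hom.app y = 𝟙 _ := rfl

/-- Along `δ_□ = id_𝒳` the augmentation 2-cell is the identity. [cite: MochizukiAbsTopIII2015, Cor 3.7 (ii) p.87] -/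
theorem overE_μ_diagBox_hom_app (y : X) :
    (𝔖.overE.μ Cor37Edge.diagBox).hom.app y = 𝟙 _ := rfl

/-- **Cross condition on the type-(1) generator.** Under (Hlog), `K₀`'s homotopy at
`([toGal]∘[λ^×]∘[pr_⋎]∘[log_𝒳]∘[γ], [toGal]∘[λ^{×pf}]∘[pr_{⋎+1}]∘[γ])` is `(𝒩 → 𝔈)(ι_{log,⋎})` behind `γ` (up to the
`eqToHom`s of `pathFunctor_cons`; `ι_{log,⋎}` at `(A₁, A₂, α)` is `ι_log` at the first factor `A₁`): the 2-cells
`lamTimesGal_{log A₁}`, `logGal_{A₁}` picked up along the left path and `lamTimesPfGal_{A₁}` along the right path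
are exactly the three factors of (Hlog). [cite: MochizukiAbsTopIII2015, Cor 3.7 (iii) p.88] -/
theorem coresFamily_η_logGal_app
    (hι : ∀ A : X, 𝔖.spaceGal.map (𝔖.iotaLog.app A) =
      𝔖.lamTimesGal.hom.app (𝔖.log.obj A) ≫ 𝔖.logGal.hom.app A ≫ 𝔖.lamTimesPfGal.inv.app A)
    {a : Cor37Vertex} (n : ℤ) (γ : Path a (.first (n + 1)))
    (h : 𝔖.coresFamily.E
      ((((γ.cons (Cor37Edge.log.{u} (n + 1) n rfl)).cons (Cor37Edge.pr.{u} n)).cons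
        (Cor37Edge.lamTimes.{u} : Cor37Vertex.box ⟶ .space)).cons
        (Cor37Edge.toGal.{u} : Cor37Vertex.space ⟶ .galois))
      (((γ.cons (Cor37Edge.pr.{u} (n + 1))).cons
        (Cor37Edge.lamTimesPf.{u} : Cor37Vertex.box ⟶ .space)).cons
        (Cor37Edge.toGal.{u} : Cor37Vertex.space ⟶ .galois)))
    (x : 𝔖.starDiagram.obj a) :
    (𝔖.coresFamily.η h).app x =
      eqToHom (by rw [pathFunctor_cons, pathFunctor_cons, pathFunctor_cons, pathFunctor_cons]; rfl) ≫
        𝔖.spaceGal.map (𝔖.iotaLog.app ((𝔖.starDiagram.pathFunctor γ).obj x).fst) ≫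
        eqToHom (by rw [pathFunctor_cons, pathFunctor_cons, pathFunctor_cons]; rfl) := by
  have hY3 : (𝔖.starDiagram.pathFunctor ((γ.cons (Cor37Edge.log.{u} (n + 1) n rfl)).cons
      (Cor37Edge.pr.{u} n))).obj x = 𝔖.log.obj ((𝔖.starDiagram.pathFunctor γ).obj x).fst := by
    rw [pathFunctor_cons, pathFunctor_cons]; rfl
  have hY2 : (𝔖.starDiagram.pathFunctor (γ.cons (Cor37Edge.pr.{u} (n + 1)))).obj x =
      ((𝔖.starDiagram.pathFunctor γ).obj x).fst := by
    rw [pathFunctor_cons]; rfl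
  refine (cancel_mono ((𝔖.overE.pathIso
    (((γ.cons (Cor37Edge.pr.{u} (n + 1))).cons
        (Cor37Edge.lamTimesPf.{u} : Cor37Vertex.box ⟶ .space)).cons
        (Cor37Edge.toGal.{u} : Cor37Vertex.space ⟶ .galois))).hom.app x)).1 ?_
  refine (𝔖.coresFamily_η_app_comp_pathIso _ _ h x).trans ?_
  simp only [OverData.pathIso_cons_app, overE_μ_toGal_hom_app, overE_μ_lamTimes_hom_app,
    overE_μ_lamTimesPf_hom_app, overE_μ_pr_hom_app, overE_μ_log_hom_app]
  rw [hι, NatTrans.congr 𝔖.lamTimesGal.hom hY3, NatTrans.congr 𝔖.lamTimesPfGal.hom hY2]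
  simp only [eqToHom_map]
  repeat erw [Category.assoc]
  repeat erw [Category.id_comp]
  repeat erw [eqToHom_trans_assoc]
  erw [eqToHom_refl, Category.id_comp]
  erw [eqToHom_refl, Category.id_comp]
  erw [eqToHom_refl, Category.id_comp]
  erw [Iso.inv_hom_id_app_assoc]
  rfl

/-- The same at `γ = ∅` (the type-(1) generator itself, whiskered into `𝔈`): `K₀`'s homotopy at
`([toGal]∘[λ^×]∘[pr_⋎]∘[log_𝒳], [toGal]∘[λ^{×pf}]∘[pr_{⋎+1}])` is `(𝒩 → 𝔈)(ι_log)` at the first factor.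
[cite: MochizukiAbsTopIII2015, Cor 3.7 (iii) p.88] -/
theorem coresFamily_η_logGal_app_nil
    (hι : ∀ A : X, 𝔖.spaceGal.map (𝔖.iotaLog.app A) =
      𝔖.lamTimesGal.hom.app (𝔖.log.obj A) ≫ 𝔖.logGal.hom.app A ≫ 𝔖.lamTimesPfGal.inv.app A)
    (n : ℤ)
    (h : 𝔖.coresFamily.E
      (((((Path.nil : Path (Cor37Vertex.first (n + 1)) (.first (n + 1))).cons
        (Cor37Edge.log.{u} (n + 1) n rfl)).cons (Cor37Edge.pr.{u} n)).cons
        (Cor37Edge.lamTimes.{u} : Cor37Vertex.box ⟶ .space)).cons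
        (Cor37Edge.toGal.{u} : Cor37Vertex.space ⟶ .galois))
      ((((Path.nil : Path (Cor37Vertex.first (n + 1)) (.first (n + 1))).cons
        (Cor37Edge.pr.{u} (n + 1))).cons
        (Cor37Edge.lamTimesPf.{u} : Cor37Vertex.box ⟶ .space)).cons
        (Cor37Edge.toGal.{u} : Cor37Vertex.space ⟶ .galois)))
    (y : 𝔖.Sq) :
    (𝔖.coresFamily.η h).app y =
      eqToHom (by rw [pathFunctor_cons, pathFunctor_cons, pathFunctor_cons, pathFunctor_cons,
          pathFunctor_nil]; rfl) ≫
        𝔖.spaceGal.map (𝔖.iotaLog.app y.fst) ≫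
        eqToHom (by rw [pathFunctor_cons, pathFunctor_cons, pathFunctor_cons, pathFunctor_nil]; rfl) := by
  rw [𝔖.coresFamily_η_logGal_app hι n Path.nil h y]
  have e : ((𝔖.starDiagram.pathFunctor (Path.nil : Path (Cor37Vertex.first (n + 1)) _)).obj y).fst =
      y.fst := by rw [pathFunctor_nil]; rfl
  rw [NatTrans.congr 𝔖.iotaLog e, Functor.map_comp, Functor.map_comp, eqToHom_map, eqToHom_map,
    eqToHom_map, eqToHom_map]
  repeat erw [Category.assoc]
  repeat erw [eqToHom_trans_assoc]
  erw [eqToHom_trans]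

/-- The type-(2) lemma at `γ = ∅` (the type-(2) generator itself, whiskered into `𝔈`): `K₀`'s homotopy at
`([toGal]∘[λ^×], [toGal]∘[λ^{×pf}])` is `(𝒩 → 𝔈)(ι_×)`. [cite: MochizukiAbsTopIII2015, Cor 3.7 (iii) p.88] -/
theorem coresFamily_η_timesGal_app_nil
    (hι : ∀ y : X, 𝔖.spaceGal.map (𝔖.iotaTimes.app y) =
      𝔖.lamTimesGal.hom.app y ≫ 𝔖.lamTimesPfGal.inv.app y)
    (h : 𝔖.coresFamily.E
      (((Path.nil : Path Cor37Vertex.box .box).cons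
        (Cor37Edge.lamTimes.{u} : Cor37Vertex.box ⟶ .space)).cons
        (Cor37Edge.toGal.{u} : Cor37Vertex.space ⟶ .galois))
      (((Path.nil : Path Cor37Vertex.box .box).cons
        (Cor37Edge.lamTimesPf.{u} : Cor37Vertex.box ⟶ .space)).cons
        (Cor37Edge.toGal.{u} : Cor37Vertex.space ⟶ .galois)))
    (y : X) :
    (𝔖.coresFamily.η h).app y =
      eqToHom (by rw [pathFunctor_cons, pathFunctor_cons, pathFunctor_nil]; rfl) ≫
        𝔖.spaceGal.map (𝔖.iotaTimes.app y) ≫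
        eqToHom (by rw [pathFunctor_cons, pathFunctor_cons, pathFunctor_nil]; rfl) := by
  rw [𝔖.coresFamily_η_timesGal_app hι Path.nil h y]
  have e : (𝔖.starDiagram.pathFunctor (Path.nil : Path Cor37Vertex.box .box)).obj y = y := by
    rw [pathFunctor_nil]; rfl
  rw [NatTrans.congr 𝔖.iotaTimes e, Functor.map_comp, Functor.map_comp, eqToHom_map, eqToHom_map,
    eqToHom_map, eqToHom_map]
  repeat erw [Category.assoc]
  repeat erw [eqToHom_trans_assoc]
  erw [eqToHom_trans]

end BiAnabelianSetting

end Literature.AnabelianGeometry.AbsoluteAnabelian.AbsTopIII
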